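/-
Copyright (c) 2026 the pub-hodgecm-mathlib formalisation cell (harness21).  Prover seat hodgecm-mathlib-K2E3-p14 (g2), Track B «K2-LIT» ∕ h413
(`stmt-HodgeConjecture-24833`), unit U12 «Harish-Chandra characters» of the line `K2_E3_EllipticInputs`, socket U12-h ‹#9L› `sig_K2E3CharLocConstNearRegular`:
package [Fr-pkg] `K2E3SliceNeighbourhood` dealt BY NAME by the 9L line lead K2E3-p09 (g2) (K2 bus 2026-09-03T23:50:56Z ∕ 23:51:44Z).  2026-09-03.
-/
import Summits.HodgeConjecture.HodgeConjecture.Theorems.K2E3UnitaryCongruenceFiltration     -- ★ p855816 (this seat): filtration pack; brings ★ p855784 (levels along `e : G ≃ₜ* ↥U`, slice set, torus levels, heights) + ★ p855729 part 1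
import Summits.HodgeConjecture.HodgeConjecture.Theorems.K2E3CongruenceFrameGL                -- ★ p855840 (this seat): the same along `e : G ≃ₜ* GL (Fin n) F` (split places)
import Summits.HodgeConjecture.HodgeConjecture.Theorems.K2E3RegularConjugationOpenNonsplit    -- ★ L1 p855243 (K2E3-p09): `conj_torus_mem_nhds_of_isRegularElt` (non-split `v`)
import Summits.HodgeConjecture.HodgeConjecture.Theorems.K2E3RegularConjugationOpenSplit       -- ★ L1 p855271 (K2E3-p09): `conj_torus_mem_nhds_of_isRegularElt_split` (split `v`)
import HarnessLib

/-!
# Crux `H413` — K2-LIT E3 «EllipticInputs», U12-h package [Fr-pkg]: THE SLICE NEIGHBOURHOOD OF A REGULAR POINT — an open `𝒰 ∋ γ`, every point of which is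
# `x (γ t) x⁻¹` with `x ∈ K₁ = Kf ν` and `t ∈ T₁ = Kf mT ∩ Z(γ)`, which contains `γ · Kf N₁` for all deep `N₁`, with the height of `e (γ t)` UNIFORMLY bounded on `T₁`

Cell `hodgecm-mathlib`, Track B «K2-LIT», crux item `stmt-HodgeConjecture-24833` (h413), line `K2_E3_EllipticInputs`, unit U12 «HC characters», socket U12-h
`sig_K2E3CharLocConstNearRegular` (‹#9L›).  Deal [Fr-pkg] of the 9L line lead (K2E3-p09 (g2), K2 bus 2026-09-03T23:50:56Z): «∀ γ ∈ G regular, ∀ ν mT : ℕ: with `K₁ := Kf ν`,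
`T₁ := {t ∈ Kf mT | e t ∈ Z(e γ)}`: ∃ 𝒰 open, γ ∈ 𝒰 ∧ (∀ y ∈ 𝒰, ∃ t ∈ T₁, ∃ x ∈ K₁, y = x (γ t) x⁻¹) ∧ (∃ N₂, ∀ N₁ ≥ N₂, ∀ x ∈ Kf N₁, γ x ∈ 𝒰) ∧ (∃ h, ∀ t ∈ T₁,
height(e(γt)) ≤ h) — i.e. 𝒰 := interior((γT₁)^{K₁}) via ★ L1 + ★ (Fr)» — the `𝒰`-hypotheses of ★ p855808 `exists_nhds_levelTraceStable_of_bricks` (NO `K₀` factor).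
`--supports stmt-HodgeConjecture-24833 --as helper`.  THEOREMS ONLY — no `def`, no named fact, no instance, no notation, no `sorry`.  HONEST LABEL: HC_CM is proved only modulo the
7 printed citations (2 remaining named inputs: hLiu418 = stmt-HodgeConjecture-24832, h413 = stmt-HodgeConjecture-24833) until rung 0 closes; count-neutral plumbing.

THE CONSTRUCTION [HarishChandra1999, §18 p. 79 «(γU_M)^G is an open neighbourhood of γ», §19 p. 84; HarishChandra1970, Part I §3 Lemma 20].  In a topological group `G` let `γ`
have the L1 PROPERTY — for every `W ∈ 𝓝 1` and `O ∈ 𝓝 γ` the set `{x t x⁻¹ : x ∈ W, t ∈ Z(γ), t ∈ O}` is a neighbourhood of `γ` (★ p855243 at a non-split place, ★ p855271 at a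
split place, for `γ` regular semisimple: Harish-Chandra's submersion).  Apply it with `W := K₁` (an open subgroup) and `O := γ · KT` (`KT` an open subgroup): the L1 set `A` is a
neighbourhood of `γ`, so `𝒰 := interior A` is OPEN, contains `γ`, is itself a neighbourhood of `γ` (hence contains `γ · Kf N₁` for `N₁` large, ★ p855784
`exists_forall_mul_mem_of_mem_nhds`, and then for all larger `N₁` by antitonicity), and each `y ∈ 𝒰 ⊆ A` reads `y = x t x⁻¹ = x (γ t′) x⁻¹` with `t′ := γ⁻¹ t ∈ KT ∩ Z(γ)`.
The height bound is ★ p855784 `exists_height_of_isCompact_transport` on the compact `γ · Kf mT`.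

* §1 `exists_open_slice_core` — the core in ANY topological group, from the L1 property and two neighbourhoods `K₁, KT` of `1` (subgroups): `∃ 𝒰` open, `γ ∈ 𝒰`, `𝒰 ∈ 𝓝 γ`,
  reader `y = x (γ t) x⁻¹` (`x ∈ K₁`, `t ∈ KT ∩ Z(γ)`); `map_mem_centralizer_singleton_iff` — `e t ∈ Z(e γ) ↔ t ∈ Z(γ)` along any `e : G ≃ₜ* G′` (the deal's spelling of `T₁`).
* §2 **`exists_sliceNeighbourhood`** (`e : G ≃ₜ* ↥U`, `U ≤ GL_n(F)` closed, ★ p855784 levels) and **`exists_sliceNeighbourhood_GL`** (`e : G ≃ₜ* GL (Fin n) F`, ★ p855840 levels):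
  the deal VERBATIM — `𝒰` open, `γ ∈ 𝒰`, reader with `t ∈ Kf mT`, `t ∈ Z(γ)`, `x ∈ Kf ν`, depth clause `∃ N₂, ∀ N₁ ≥ N₂, ∀ x ∈ Kf N₁, γ * x ∈ 𝒰`, uniform height
  `∃ h, ∀ t ∈ Kf mT, ValBound (|ϖ|^h)⁻¹ (e (γ t)) ∧ ValBound (|ϖ|^h)⁻¹ (e (γ t))⁻¹` (on all of `γ · Kf mT ⊇ γT₁`).
* §3 THE CM DRESS with the L1 hypothesis DISCHARGED (★ p855243 ∕ ★ p855271) and `e` left GENERIC (plug `e := localNonsplitEquiv …`, resp. the `localSplitEquiv` composite `ψ`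
  of ★ p855271, no transport cast in the statement): `exists_sliceNeighbourhood_cm_nonsplit`, `exists_sliceNeighbourhood_cm_split`.

## References
* [HarishChandra1999] Harish-Chandra (DeBacker–Sally), *Admissible Invariant Distributions on Reductive p-adic Groups*, ULECT 16 (1999), §18 p. 79, §19 pp. 84–86.
* [HarishChandra1970] Harish-Chandra (van Dijk), *Harmonic Analysis on Reductive p-adic Groups*, LNM 162 (1970), Part I §3 Lemma 20.
* [BernsteinZelevinsky1976] I. N. Bernstein, A. V. Zelevinsky, Russian Math. Surveys 31:3 (1976), §1.1 (congruence subgroups as a neighbourhood basis).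
-/

set_option autoImplicit false
-- the mandated namespace repeats `HodgeConjecture.HodgeConjecture`, as in every `Theorems/*.lean` of this sub-problem
set_option linter.dupNamespace false

noncomputable section

open Topology Filter Set ValuativeRel Matrix
open NumberField IsDedekindDomain
open Literature.NumberTheory.Automorphic Literature.NumberTheory.Automorphic.UnitaryGroup Literature.NumberTheory.GaloisRepresentations Literature.NumberTheory.Rogawski1990
open Summit.HodgeConjecture.HodgeConjecture.Cruxes.H413 Summit.HodgeConjecture.HodgeConjecture.Cruxes.H413.K2E3SubgroupCongruenceLevels
  Summit.HodgeConjecture.HodgeConjecture.Cruxes.H413.K2E3UnitaryCongruenceFrame Summit.HodgeConjecture.HodgeConjecture.Cruxes.H413.K2E3CongruenceFrameGL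
open scoped MatrixGroups Pointwise

namespace Summit.HodgeConjecture.HodgeConjecture.Cruxes.H413.K2E3SliceNeighbourhood

/-! ## §1 The core in a topological group with the L1 property -/

section Core

variable {G : Type*} [Group G] [TopologicalSpace G] [IsTopologicalGroup G]

/-- **THE SLICE NEIGHBOURHOOD, CORE FORM.**  If `γ` has the L1 property (conjugates of nearby centraliser points by small elements form a neighbourhood of `γ`) and `K₁`, `KT` are
subgroups that are neighbourhoods of `1`, then `𝒰 := interior {x t x⁻¹ : x ∈ K₁, t ∈ Z(γ) ∩ γ·KT}` is open, contains `γ`, is a neighbourhood of `γ`, and every `y ∈ 𝒰` is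
`x (γ t) x⁻¹` with `x ∈ K₁`, `t ∈ KT ∩ Z(γ)`. [cite: HarishChandra1999, §18 p. 79, §19 p. 84] [cite: HarishChandra1970, Part I §3 Lemma 20] -/
theorem exists_open_slice_core (γ : G)
    (hL1 : ∀ W ∈ 𝓝 (1 : G), ∀ O ∈ 𝓝 γ,
      {g : G | ∃ x ∈ W, ∃ t : ↥(Subgroup.centralizer ({γ} : Set G)), (t : G) ∈ O ∧ g = x * (t : G) * x⁻¹} ∈ 𝓝 γ)
    (K₁ KT : Subgroup G) (hK₁ : (K₁ : Set G) ∈ 𝓝 (1 : G)) (hKT : (KT : Set G) ∈ 𝓝 (1 : G)) :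
    ∃ 𝒰 : Set G, IsOpen 𝒰 ∧ γ ∈ 𝒰 ∧ 𝒰 ∈ 𝓝 γ ∧
      ∀ y ∈ 𝒰, ∃ t ∈ KT, t ∈ Subgroup.centralizer ({γ} : Set G) ∧ ∃ x ∈ K₁, y = x * (γ * t) * x⁻¹ := by
  -- `O := γ · KT`, a neighbourhood of `γ`
  have hO : (fun g : G => γ⁻¹ * g) ⁻¹' (KT : Set G) ∈ 𝓝 γ :=
    (continuous_const_mul γ⁻¹).continuousAt.preimage_mem_nhds (by rwa [inv_mul_cancel])
  have hA := hL1 (K₁ : Set G) hK₁ _ hO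
  refine ⟨interior {g : G | ∃ x ∈ (K₁ : Set G), ∃ t : ↥(Subgroup.centralizer ({γ} : Set G)),
      (t : G) ∈ (fun g : G => γ⁻¹ * g) ⁻¹' (KT : Set G) ∧ g = x * (t : G) * x⁻¹}, isOpen_interior, mem_interior_iff_mem_nhds.2 hA, interior_mem_nhds.2 hA,
    fun y hy => ?_⟩
  obtain ⟨x, hx, t, ht, rfl⟩ := interior_subset hy
  refine ⟨γ⁻¹ * (t : G), ht, ?_, x, hx, by rw [mul_inv_cancel_left]⟩
  exact Subgroup.mul_mem _ (Subgroup.inv_mem _ (Subgroup.mem_centralizer_singleton_iff.2 rfl)) t.2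

omit [IsTopologicalGroup G] in
/-- The deal's spelling of the torus: along any topological-group isomorphism `e`, `e t ∈ Z(e γ) ↔ t ∈ Z(γ)`. [cite: HarishChandra1999, §19 p. 84] -/
theorem map_mem_centralizer_singleton_iff {G' : Type*} [Group G'] [TopologicalSpace G'] (e : G ≃ₜ* G') (γ t : G) :
    e t ∈ Subgroup.centralizer ({e γ} : Set G') ↔ t ∈ Subgroup.centralizer ({γ} : Set G) := by
  rw [Subgroup.mem_centralizer_singleton_iff, Subgroup.mem_centralizer_singleton_iff, ← map_mul, ← map_mul, e.apply_eq_iff_eq]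

omit [IsTopologicalGroup G] in
/-- … and read on the coercion to `GL_n(F)` when `e` lands in a subgroup `U`: `↑(e t) · ↑(e γ) = ↑(e γ) · ↑(e t) ↔ t ∈ Z(γ)`. [cite: HarishChandra1999, §19 p. 84] -/
theorem coe_map_comm_iff {M : Type*} [Group M] [TopologicalSpace M] {U : Subgroup M} (e : G ≃ₜ* U) (γ t : G) :
    ((e t : U) : M) * ((e γ : U) : M) = ((e γ : U) : M) * ((e t : U) : M) ↔ t ∈ Subgroup.centralizer ({γ} : Set G) := by
  rw [← map_mem_centralizer_singleton_iff e, Subgroup.mem_centralizer_singleton_iff, ← Subgroup.coe_mul, ← Subgroup.coe_mul, Subtype.ext_iff]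

end Core

/-! ## §2 The package along `e : G ≃ₜ* ↥U` (non-split frame) and along `e : G ≃ₜ* GL (Fin n) F` (split frame) -/

section Package

variable {F : Type*} [Field F] [ValuativeRel F] [TopologicalSpace F] [IsNonarchimedeanLocalField F] {n : ℕ}
  {G : Type*} [Group G] [TopologicalSpace G] [IsTopologicalGroup G] {ϖ : F}

/-- **[Fr-pkg] THE SLICE NEIGHBOURHOOD along `e : G ≃ₜ* ↥U`** (`U ≤ GL_n(F)` closed; `Kf m := (congruenceGL n |ϖ|^m).comap (U.subtype.comp e)` of ★ p855784): for `γ` with the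
L1 property and every `ν mT : ℕ` there is an OPEN `𝒰 ∋ γ` such that (reader) every `y ∈ 𝒰` is `x (γ t) x⁻¹` with `t ∈ Kf mT`, `t ∈ Z(γ)`, `x ∈ Kf ν`; (depth) some `N₂` has
`γ x ∈ 𝒰` for all `x ∈ Kf N₁`, `N₁ ≥ N₂`; (height) some `h` bounds the entries of the matrix of `e (γ t)` and of its inverse by `(|ϖ|^h)⁻¹` for all `t ∈ Kf mT`.
[cite: HarishChandra1999, §18 p. 79, §19 pp. 84–86] [cite: BernsteinZelevinsky1976, §1.1] -/
theorem exists_sliceNeighbourhood {U : Subgroup (GL (Fin n) F)} (e : G ≃ₜ* U) (hU : IsClosed (U : Set (GL (Fin n) F))) (hϖ : IsUniformizingElement ϖ) (γ : G)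
    (hL1 : ∀ W ∈ 𝓝 (1 : G), ∀ O ∈ 𝓝 γ,
      {g : G | ∃ x ∈ W, ∃ t : ↥(Subgroup.centralizer ({γ} : Set G)), (t : G) ∈ O ∧ g = x * (t : G) * x⁻¹} ∈ 𝓝 γ)
    (ν mT : ℕ) :
    ∃ 𝒰 : Set G, IsOpen 𝒰 ∧ γ ∈ 𝒰 ∧
      (∀ y ∈ 𝒰, ∃ t ∈ (congruenceGL n (valuation F ϖ ^ mT)).comap (U.subtype.comp e.toMulEquiv.toMonoidHom),
        t ∈ Subgroup.centralizer ({γ} : Set G) ∧ ∃ x ∈ (congruenceGL n (valuation F ϖ ^ ν)).comap (U.subtype.comp e.toMulEquiv.toMonoidHom), y = x * (γ * t) * x⁻¹) ∧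
      (∃ N₂ : ℕ, ∀ N₁ : ℕ, N₂ ≤ N₁ → ∀ x ∈ (congruenceGL n (valuation F ϖ ^ N₁)).comap (U.subtype.comp e.toMulEquiv.toMonoidHom), γ * x ∈ 𝒰) ∧
      (∃ h : ℕ, ∀ t ∈ (congruenceGL n (valuation F ϖ ^ mT)).comap (U.subtype.comp e.toMulEquiv.toMonoidHom),
        ValBound (valuation F ϖ ^ h)⁻¹ (((e (γ * t) : U) : GL (Fin n) F) : Matrix (Fin n) (Fin n) F) ∧
          ValBound (valuation F ϖ ^ h)⁻¹ ((((e (γ * t) : U) : GL (Fin n) F)⁻¹ : GL (Fin n) F) : Matrix (Fin n) (Fin n) F)) := by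
  have hϖ0 : ϖ ≠ 0 := hϖ.ne_zero
  have hϖ1 : valuation F ϖ < 1 := hϖ.valuation_lt_one
  have hopen : ∀ m : ℕ, IsOpen (((congruenceGL n (valuation F ϖ ^ m)).comap (U.subtype.comp e.toMulEquiv.toMonoidHom) : Subgroup G) : Set G) :=
    fun m => (K2E3UnitaryCongruenceFiltration.isOpen_isCompact_frame e hU hϖ0 m).1
  obtain ⟨𝒰, h𝒰o, hγ𝒰, h𝒰n, hread⟩ := exists_open_slice_core γ hL1
    ((congruenceGL n (valuation F ϖ ^ ν)).comap (U.subtype.comp e.toMulEquiv.toMonoidHom))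
    ((congruenceGL n (valuation F ϖ ^ mT)).comap (U.subtype.comp e.toMulEquiv.toMonoidHom))
    ((hopen ν).mem_nhds (Subgroup.one_mem _)) ((hopen mT).mem_nhds (Subgroup.one_mem _))
  refine ⟨𝒰, h𝒰o, hγ𝒰, fun y hy => ?_, ?_, ?_⟩
  · obtain ⟨t, ht, htc, x, hx, rfl⟩ := hread y hy
    exact ⟨t, ht, htc, x, hx, rfl⟩
  · obtain ⟨N₂, hN₂⟩ := exists_forall_mul_mem_of_mem_nhds e hϖ0 hϖ1 γ h𝒰n
    exact ⟨N₂, fun N₁ hN₁ x hx => hN₂ x (comap_congruenceGL_pow_le_of_le e hϖ hN₁ hx)⟩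
  · have hc : IsCompact ((fun t : G => γ * t) '' (((congruenceGL n (valuation F ϖ ^ mT)).comap (U.subtype.comp e.toMulEquiv.toMonoidHom) : Subgroup G) : Set G)) :=
      ((K2E3UnitaryCongruenceFiltration.isOpen_isCompact_frame e hU hϖ0 mT).2).image (continuous_const_mul γ)
    obtain ⟨h, hh⟩ := exists_height_of_isCompact_transport e hϖ0 hϖ1 hc
    exact ⟨h, fun t ht => hh (γ * t) (Set.mem_image_of_mem _ ht)⟩

/-- **[Fr-pkg] THE SLICE NEIGHBOURHOOD along `e : G ≃ₜ* GL (Fin n) F`** (split frame; `Kf m := (congruenceGL n |ϖ|^m).comap e` of ★ p855840): same statement with heights of `e (γ t)`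
read in `GL_n(F)`. [cite: HarishChandra1999, §18 p. 79, §19 pp. 84–86] [cite: BernsteinZelevinsky1976, §1.1] -/
theorem exists_sliceNeighbourhood_GL (e : G ≃ₜ* GL (Fin n) F) (hϖ : IsUniformizingElement ϖ) (γ : G)
    (hL1 : ∀ W ∈ 𝓝 (1 : G), ∀ O ∈ 𝓝 γ,
      {g : G | ∃ x ∈ W, ∃ t : ↥(Subgroup.centralizer ({γ} : Set G)), (t : G) ∈ O ∧ g = x * (t : G) * x⁻¹} ∈ 𝓝 γ)
    (ν mT : ℕ) :
    ∃ 𝒰 : Set G, IsOpen 𝒰 ∧ γ ∈ 𝒰 ∧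
      (∀ y ∈ 𝒰, ∃ t ∈ (congruenceGL n (valuation F ϖ ^ mT)).comap e.toMulEquiv.toMonoidHom,
        t ∈ Subgroup.centralizer ({γ} : Set G) ∧ ∃ x ∈ (congruenceGL n (valuation F ϖ ^ ν)).comap e.toMulEquiv.toMonoidHom, y = x * (γ * t) * x⁻¹) ∧
      (∃ N₂ : ℕ, ∀ N₁ : ℕ, N₂ ≤ N₁ → ∀ x ∈ (congruenceGL n (valuation F ϖ ^ N₁)).comap e.toMulEquiv.toMonoidHom, γ * x ∈ 𝒰) ∧
      (∃ h : ℕ, ∀ t ∈ (congruenceGL n (valuation F ϖ ^ mT)).comap e.toMulEquiv.toMonoidHom,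
        ValBound (valuation F ϖ ^ h)⁻¹ ((e (γ * t) : GL (Fin n) F) : Matrix (Fin n) (Fin n) F) ∧
          ValBound (valuation F ϖ ^ h)⁻¹ (((e (γ * t))⁻¹ : GL (Fin n) F) : Matrix (Fin n) (Fin n) F)) := by
  have hϖ0 : ϖ ≠ 0 := hϖ.ne_zero
  have hϖ1 : valuation F ϖ < 1 := hϖ.valuation_lt_one
  have hopen : ∀ m : ℕ, IsOpen (((congruenceGL n (valuation F ϖ ^ m)).comap e.toMulEquiv.toMonoidHom : Subgroup G) : Set G) :=
    fun m => (isOpen_isCompact_frameGL e hϖ0 m).1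
  obtain ⟨𝒰, h𝒰o, hγ𝒰, h𝒰n, hread⟩ := exists_open_slice_core γ hL1
    ((congruenceGL n (valuation F ϖ ^ ν)).comap e.toMulEquiv.toMonoidHom) ((congruenceGL n (valuation F ϖ ^ mT)).comap e.toMulEquiv.toMonoidHom)
    ((hopen ν).mem_nhds (Subgroup.one_mem _)) ((hopen mT).mem_nhds (Subgroup.one_mem _))
  refine ⟨𝒰, h𝒰o, hγ𝒰, fun y hy => ?_, ?_, ?_⟩
  · obtain ⟨t, ht, htc, x, hx, rfl⟩ := hread y hy
    exact ⟨t, ht, htc, x, hx, rfl⟩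
  · obtain ⟨N₂, hN₂⟩ := exists_forall_mul_mem_of_mem_nhds_GL e hϖ0 hϖ1 γ h𝒰n
    exact ⟨N₂, fun N₁ hN₁ x hx => hN₂ x (comapGL_congruenceGL_pow_le_of_le e hϖ hN₁ hx)⟩
  · have hc : IsCompact ((fun t : G => γ * t) '' (((congruenceGL n (valuation F ϖ ^ mT)).comap e.toMulEquiv.toMonoidHom : Subgroup G) : Set G)) :=
      ((isOpen_isCompact_frameGL e hϖ0 mT).2).image (continuous_const_mul γ)
    obtain ⟨h, hh⟩ := exists_height_of_isCompact_transportGL e hϖ0 hϖ1 hc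
    exact ⟨h, fun t ht => hh (γ * t) (Set.mem_image_of_mem _ ht)⟩

end Package

/-! ## §3 The CM dress: L1 discharged (★ p855243 ∕ ★ p855271), `e` generic -/

section CM

variable (L : Type) [Field L] [NumberField L] [IsCMField L] {N : ℕ} (H : Matrix (Fin N) (Fin N) L) {v : HeightOneSpectrum (𝓞 ↥(maximalRealSubfield L))}

/-- **[Fr-pkg] AT A NON-SPLIT PLACE of `U_N(H)(L⁺_v)`** (`det H` a unit, `w ∣ v` with `c • w = w`, `γ` regular): the slice neighbourhood for ANY model `e : (cmDatum L N H).Local v ≃ₜ* ↥U`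
onto a closed `U ≤ GL_n(F)` over a non-archimedean local field `F` (the frame uses `e := localNonsplitEquiv …`, `U := U(σ_w, H_w)(L_w)`, ★ p855784 `isClosed_unitaryGroupOfForm_placeForm`),
the L1 property being ★ p855243 `conj_torus_mem_nhds_of_isRegularElt`. [cite: HarishChandra1999, §18 p. 79, §19 pp. 84–86] [cite: HarishChandra1970, Part I §3 Lemma 20] -/
theorem exists_sliceNeighbourhood_cm_nonsplit (hHd : IsUnit H.det) (w : PlacesOver L v) (hw : IsCMField.complexConj L • w.1 = w.1)
    (γ : (cmDatum L N H).Local v) (hγ : IsRegularElt (γ.val : GL (Fin N) (LocalRing L v)))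
    {F : Type*} [Field F] [ValuativeRel F] [TopologicalSpace F] [IsNonarchimedeanLocalField F] {n : ℕ} {U : Subgroup (GL (Fin n) F)}
    (e : (cmDatum L N H).Local v ≃ₜ* U) (hU : IsClosed (U : Set (GL (Fin n) F))) {ϖ : F} (hϖ : IsUniformizingElement ϖ) (ν mT : ℕ) :
    ∃ 𝒰 : Set ((cmDatum L N H).Local v), IsOpen 𝒰 ∧ γ ∈ 𝒰 ∧
      (∀ y ∈ 𝒰, ∃ t ∈ (congruenceGL n (valuation F ϖ ^ mT)).comap (U.subtype.comp e.toMulEquiv.toMonoidHom),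
        t ∈ Subgroup.centralizer ({γ} : Set ((cmDatum L N H).Local v)) ∧
          ∃ x ∈ (congruenceGL n (valuation F ϖ ^ ν)).comap (U.subtype.comp e.toMulEquiv.toMonoidHom), y = x * (γ * t) * x⁻¹) ∧
      (∃ N₂ : ℕ, ∀ N₁ : ℕ, N₂ ≤ N₁ → ∀ x ∈ (congruenceGL n (valuation F ϖ ^ N₁)).comap (U.subtype.comp e.toMulEquiv.toMonoidHom), γ * x ∈ 𝒰) ∧
      (∃ h : ℕ, ∀ t ∈ (congruenceGL n (valuation F ϖ ^ mT)).comap (U.subtype.comp e.toMulEquiv.toMonoidHom),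
        ValBound (valuation F ϖ ^ h)⁻¹ (((e (γ * t) : U) : GL (Fin n) F) : Matrix (Fin n) (Fin n) F) ∧
          ValBound (valuation F ϖ ^ h)⁻¹ ((((e (γ * t) : U) : GL (Fin n) F)⁻¹ : GL (Fin n) F) : Matrix (Fin n) (Fin n) F)) :=
  exists_sliceNeighbourhood e hU hϖ γ
    (fun _ hW _ hO => K2E3RegularConjugationOpenNonsplit.conj_torus_mem_nhds_of_isRegularElt L H hHd w hw γ hγ hW hO) ν mT

/-- **[Fr-pkg] AT A SPLIT PLACE of `U_N(H)(L⁺_v)`** (`H` hermitian with `det H` a unit, `w ∣ v` with `c • w ≠ w`, `γ` regular): the slice neighbourhood for ANY model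
`e : (cmDatum L N H).Local v ≃ₜ* GL (Fin n) F` (the frame uses the ★ `localSplitEquiv` composite `ψ` of ★ p855271), the L1 property being ★ p855271
`conj_torus_mem_nhds_of_isRegularElt_split`. [cite: HarishChandra1999, §18 p. 79, §19 pp. 84–86] [cite: HarishChandra1970, Part I §3 Lemma 20] -/
theorem exists_sliceNeighbourhood_cm_split (hH : (H.map (cmConjRingHom L))ᵀ = H) (hHd : IsUnit H.det) (w : PlacesOver L v) (hw : IsCMField.complexConj L • w.1 ≠ w.1)
    (γ : (cmDatum L N H).Local v) (hγ : IsRegularElt (γ.val : GL (Fin N) (LocalRing L v)))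
    {F : Type*} [Field F] [ValuativeRel F] [TopologicalSpace F] [IsNonarchimedeanLocalField F] {n : ℕ}
    (e : (cmDatum L N H).Local v ≃ₜ* GL (Fin n) F) {ϖ : F} (hϖ : IsUniformizingElement ϖ) (ν mT : ℕ) :
    ∃ 𝒰 : Set ((cmDatum L N H).Local v), IsOpen 𝒰 ∧ γ ∈ 𝒰 ∧
      (∀ y ∈ 𝒰, ∃ t ∈ (congruenceGL n (valuation F ϖ ^ mT)).comap e.toMulEquiv.toMonoidHom,
        t ∈ Subgroup.centralizer ({γ} : Set ((cmDatum L N H).Local v)) ∧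
          ∃ x ∈ (congruenceGL n (valuation F ϖ ^ ν)).comap e.toMulEquiv.toMonoidHom, y = x * (γ * t) * x⁻¹) ∧
      (∃ N₂ : ℕ, ∀ N₁ : ℕ, N₂ ≤ N₁ → ∀ x ∈ (congruenceGL n (valuation F ϖ ^ N₁)).comap e.toMulEquiv.toMonoidHom, γ * x ∈ 𝒰) ∧
      (∃ h : ℕ, ∀ t ∈ (congruenceGL n (valuation F ϖ ^ mT)).comap e.toMulEquiv.toMonoidHom,
        ValBound (valuation F ϖ ^ h)⁻¹ ((e (γ * t) : GL (Fin n) F) : Matrix (Fin n) (Fin n) F) ∧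
          ValBound (valuation F ϖ ^ h)⁻¹ (((e (γ * t))⁻¹ : GL (Fin n) F) : Matrix (Fin n) (Fin n) F)) :=
  exists_sliceNeighbourhood_GL e hϖ γ
    (fun _ hW _ hO => K2E3RegularConjugationOpenSplit.conj_torus_mem_nhds_of_isRegularElt_split L H hH hHd w hw γ hγ hW hO) ν mT

end CM

end Summit.HodgeConjecture.HodgeConjecture.Cruxes.H413.K2E3SliceNeighbourhood

end
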